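import Summits.BirchSwinnertonDyer.BirchSwinnertonDyer.Theses.PrintCf2
import Summits.BirchSwinnertonDyer.BirchSwinnertonDyer.Theorems.PrintCf2RamifiedOffTYZThetaFourLeaf
import HarnessLib

/-!
# Route `PrintCf2`, aside `RamifiedThetaFourOfFactsPlus` — CLOSED: the four-prime theta-descent family of cell `bsd-monsky`
# (`n = 2p₁p₂p₃p₄`, type `(3,5,5,5)`, `g(n)` odd; isogeny classes) from the ramified bundle PLUS TYZ Thm 1.1 and the §3.1–3.2
# CM-point display, BY NAME (cell `bsd-print-cf2`, p1 g3)

HONEST FRAMING (cell `bsd-print-cf2`, run/shared/lean/pub/bsd-print-cf2/; route `PrintCf2`, leaf CornerF @ `p = 2` =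
`WAllCornerFTwo`, OPEN AS A CLASS): a CLOSING file — it imports the route file and proves ONE aside whose statement carries
its published inputs as an antecedent (facts-relative «OfFactsPlus» typing; nothing asserted, no named fact introduced):
`(𝔅_ram ∧ TianYuanZhang2017.thm11_parity_of_scriptL ∧ TianYuanZhang2017.tyz_cmPointGaloisData) →
Summit.BirchSwinnertonDyer.WAllCornerFTwoRamifiedThetaFour` (planner g4, on this seat's TURNKEY 18:51Z). The mathematics is
cell `bsd-monsky`'s (prover-B, `P2.ThetaDescent.rankOne_sha_bsdp_two_two_mul_3555_family_descent`), assembled in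
`Theorems/PrintCf2RamifiedOffTYZThetaFourLeaf.lean` (`PrintCf2.thetaFour_of_bundlePlus`, p557813) over the leaf file
`Rank1Residual/WAll/TargetCMTwoRamifiedThetaFour.lean` (p557163); here only the one-line term. Booking currency:
LITERAL-by-name(`tyz_cmPointGaloisData`). Beyond print: YES (`k = 4`; Monsky 1990 p. 67 Remark (3) conjectures `k = 2`;
TYZ Thm 1.2 silent on part of the family, e.g. `n = 11310`). [cite: Monsky1990MockHeegner, p. 67 Remark (3)]
[cite: TianYuanZhang2017, Thm. 1.1, Thm. 3.5, Thm. 3.6] [cite: Miller2011LMS, §1 and Def. 1.1]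
-/

noncomputable section

open scoped Classical

open Summit.BirchSwinnertonDyer
open Summit.BirchSwinnertonDyer.BirchSwinnertonDyer.Theses.PrintCf2

set_option autoImplicit false
-- `Summit.BirchSwinnertonDyer.BirchSwinnertonDyer.Theorems` is the layout's namespace (Sub = Summit name).
set_option linter.dupNamespace false

namespace Summit.BirchSwinnertonDyer.BirchSwinnertonDyer.Theorems

/-- **Aside `RamifiedThetaFourOfFactsPlus` holds**: `𝔅_ram ∧ TYZ Thm 1.1 ∧ the CM-point display ⟹` the four-prime theta leaf,
by `PrintCf2.thetaFour_of_bundlePlus`. [cite: TianYuanZhang2017, Thm. 1.1, Thm. 3.5, Thm. 3.6] [cite: Monsky1990MockHeegner, p. 67 Remark (3)] -/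
theorem ramifiedThetaFourOfFactsPlus_proof : RamifiedThetaFourOfFactsPlus :=
  fun h ↦ Summit.BirchSwinnertonDyer.PrintCf2.thetaFour_of_bundlePlus h

end Summit.BirchSwinnertonDyer.BirchSwinnertonDyer.Theorems

end
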